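import Summits.AnomalousDissipation.AnomalousDissipation.Theorems.SawtoothPulseCascadeK1LocalisedCascadeBadSetChord

/-!
# K1loc, line `Spectral` — S-D (first good piece): THE TORUS BAD SET WITH CORNER INEQUALITIES ONLY AT THE PHASES `j < n`

Helper file of the prover lane on the crux `K1LocalisedCascade` (stmt-AnomalousDissipation-19491), route
`SawtoothPulseCascade`, registered line `Cruxes.K1LocalisedCascade.Spectral` (one open stub `stub_highModeConcentration`).
`…BadSetChord.exists_badSet` asked `M₁δ_j/(2πN_j) + E ≤ M₃δ_j/(2πN_j)` for every `j : ℕ` (forcing `E = 0`); only `j < n` is used.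
This file re-derives it with the hypotheses restricted to `j < n` (`exists_badSet_lt`, same construction).
[cite: ElgindiLissMattingly2025, §1.2.2, §3.1] [problem: turb]
-/

-- `Summit.<Summit>.<Problem>`: single-conjunct summit, the duplicate namespace segment is deliberate.
set_option linter.dupNamespace false

noncomputable section

namespace Summit.AnomalousDissipation.AnomalousDissipation.Theorems.SawtoothPulseCascade.K1Start

open MeasureTheory Set Function UnitAddTorus
open scoped ENNReal
open Literature.Analysis Literature.Analysis.FunctionSpaces Literature.Analysis.FunctionSpaces.Torus
open Literature.Analysis.FluidPDE.ShearStage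
open Literature.Analysis.FluidPDE.SawtoothCascade Literature.Analysis.FluidPDE.SawtoothCascade.CascadeParams

section Cascade

variable (P : CascadeParams)

/-- **The near-corner parameters are a section of a small torus set** (corner inequalities only at the phases `j < n`).  For `M₃ ≥ 1`, `M₃δ_j < π/2`, and
`M₁δ_j/(2πN_j) + E_V, M₁δ_j/(2πN_j) + E_H ≤ M₃δ_j/(2πN_j)`: there is a measurable `Bad ⊆ 𝕋²` with `vol(Bad) ≤ Σ_{j<n} 2·(2M₃δ_j/π)` such that
for every chord `Y + s e₀` and its backward trajectories `z_s`, every parameter `s` at which a V-input `(z_s (j+1))₀` or an H-input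
`(z_s (j+1))₁ − γU_j((z_s (j+1))₀)` (`j < n`) is within `M₁δ_j/(2πN_j) + E` of a corner satisfies `proj(Y + s e₀) ∈ Bad`.
[cite: ElgindiLissMattingly2025, §1 (corner strips)] -/
theorem exists_badSet_lt (hδ₀ : 0 < P.δ₀) (hd : 0 < P.d) (hN₀ : 1 ≤ P.N₀) (hρ : 1 ≤ P.ρN) {M₁ M₃ EV EH : ℝ} {n : ℕ} (hM₃ : 1 ≤ M₃)
    (hM₃δ : ∀ j, M₃ * P.δ j < Real.pi / 2)
    (hV3 : ∀ j, j < n → M₁ * P.δ j / (2 * Real.pi * P.N j) + EV ≤ M₃ * P.δ j / (2 * Real.pi * P.N j))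
    (hH3 : ∀ j, j < n → M₁ * P.δ j / (2 * Real.pi * P.N j) + EH ≤ M₃ * P.δ j / (2 * Real.pi * P.N j)) :
    ∃ Bad : Set (UnitAddTorus (Fin 2)), MeasurableSet Bad ∧
      volume Bad ≤ ∑ j ∈ Finset.range n, 2 * ENNReal.ofReal (2 * M₃ * P.δ j / Real.pi) ∧
      ∀ (Y : EuclideanSpace ℝ (Fin 2)) (z : ℝ → ℕ → EuclideanSpace ℝ (Fin 2)),
        (∀ s, z s n = Y + s • EuclideanSpace.single 0 1) →
        (∀ s, ∀ j < n, z s j = shearMapLift 0 1 (amp ⟨P.U j, P.U_periodic j, P.contDiff_U (P.δ_pos hδ₀ hd j)⟩ P.γ)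
          (shearMapLift 1 0 (amp ⟨P.U j, P.U_periodic j, P.contDiff_U (P.δ_pos hδ₀ hd j)⟩ P.γ) (z s (j + 1)))) →
        ∀ s : ℝ, (∃ j', j' < n ∧ ∃ q : ℤ,
          |(z s (j' + 1)) 0 - ((q : ℝ) / 2 + 1 / 4) / P.N j'| < M₁ * P.δ j' / (2 * Real.pi * P.N j') + EV ∨
          |((z s (j' + 1)) 1 - P.γ * P.U j' ((z s (j' + 1)) 0)) - ((q : ℝ) / 2 + 1 / 4) / P.N j'| <
            M₁ * P.δ j' / (2 * Real.pi * P.N j') + EH) →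
          proj (Y + s • EuclideanSpace.single 0 1) ∈ Bad := by
  -- the corner arcs of depth `M₃` and the stage shears
  set arcs : ℕ → Set UnitAddCircle := fun j => ⋃ m ∈ Finset.range (2 * P.N j), (QuotientAddGroup.mk : ℝ → UnitAddCircle) ''
    Icc ((1 / 4 + (m : ℝ) / 2) / P.N j - M₃ * P.δ j / (2 * Real.pi * P.N j))
      ((1 / 4 + (m : ℝ) / 2) / P.N j + M₃ * P.δ j / (2 * Real.pi * P.N j)) with harcs
  have harc : ∀ j, MeasurableSet (arcs j) ∧ volume (arcs j) ≤ ENNReal.ofReal (2 * M₃ * P.δ j / Real.pi) :=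
    fun j => volume_cornerArcs_le P hδ₀ hd hN₀ hρ hM₃ (hM₃δ j)
  set SV : ℕ → UnitAddTorus (Fin 2) → UnitAddTorus (Fin 2) :=
    fun j => shearMap 1 0 (amp ⟨P.U j, P.U_periodic j, P.contDiff_U (P.δ_pos hδ₀ hd j)⟩ P.γ) with hSV
  set SH : ℕ → UnitAddTorus (Fin 2) → UnitAddTorus (Fin 2) :=
    fun j => shearMap 0 1 (amp ⟨P.U j, P.U_periodic j, P.contDiff_U (P.δ_pos hδ₀ hd j)⟩ P.γ) with hSH
  -- the recursion: `C (j+1) = {x₀ ∈ arcs j} ∪ SV_j⁻¹({x₁ ∈ arcs j} ∪ SH_j⁻¹(C j))`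
  let C : ℕ → Set (UnitAddTorus (Fin 2)) := fun j => Nat.rec (∅ : Set (UnitAddTorus (Fin 2)))
    (fun j Cj => {x | x 0 ∈ arcs j} ∪ SV j ⁻¹' ({x | x 1 ∈ arcs j} ∪ SH j ⁻¹' Cj)) j
  have hC0 : C 0 = ∅ := rfl
  have hCsucc : ∀ j, C (j + 1) = {x | x 0 ∈ arcs j} ∪ SV j ⁻¹' ({x | x 1 ∈ arcs j} ∪ SH j ⁻¹' C j) := fun j => rfl
  have hSVm : ∀ j, Measurable (SV j) := fun j => (continuous_shearMap _ _ _).measurable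
  have hSHm : ∀ j, Measurable (SH j) := fun j => (continuous_shearMap _ _ _).measurable
  have hstrip : ∀ j (l : Fin 2), MeasurableSet {x : UnitAddTorus (Fin 2) | x l ∈ arcs j} :=
    fun j l => measurableSet_preimage (measurable_pi_apply l) (harc j).1
  have hCmeas : ∀ j, MeasurableSet (C j) := by
    intro j
    induction j with
    | zero => rw [hC0]; exact MeasurableSet.empty
    | succ j ih =>
      rw [hCsucc]
      exact (hstrip j 0).union (measurableSet_preimage (hSVm j) ((hstrip j 1).union (measurableSet_preimage (hSHm j) ih)))
  have hCvol : ∀ j, volume (C j) ≤ ∑ i ∈ Finset.range j, 2 * ENNReal.ofReal (2 * M₃ * P.δ i / Real.pi) := by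
    intro j
    induction j with
    | zero => simp [hC0]
    | succ j ih =>
      rw [hCsucc, Finset.sum_range_succ, union_comm]
      have h1 : volume (SV j ⁻¹' ({x | x 1 ∈ arcs j} ∪ SH j ⁻¹' C j) ∪ {x : UnitAddTorus (Fin 2) | x 0 ∈ arcs j}) ≤
          volume ({x | x 1 ∈ arcs j} ∪ SH j ⁻¹' C j) + volume (arcs j) :=
        volume_preimage_union_strip_le (by decide) _ ((hstrip j 1).union (measurableSet_preimage (hSHm j) (hCmeas j)))
          0 (harc j).1
      have h2 : volume ({x : UnitAddTorus (Fin 2) | x 1 ∈ arcs j} ∪ SH j ⁻¹' C j) ≤ volume (C j) + volume (arcs j) := by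
        rw [union_comm]; exact volume_preimage_union_strip_le (by decide) _ (hCmeas j) 1 (harc j).1
      calc _ ≤ volume ({x | x 1 ∈ arcs j} ∪ SH j ⁻¹' C j) + volume (arcs j) := h1
        _ ≤ (volume (C j) + volume (arcs j)) + volume (arcs j) := add_le_add h2 le_rfl
        _ ≤ (∑ i ∈ Finset.range j, 2 * ENNReal.ofReal (2 * M₃ * P.δ i / Real.pi)) +
              2 * ENNReal.ofReal (2 * M₃ * P.δ j / Real.pi) := by
            rw [add_assoc, ← two_mul]
            exact add_le_add ih (by gcongr; exact (harc j).2)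
  refine ⟨C n, hCmeas n, hCvol n, fun Y z hzn hz s hnear => ?_⟩
  -- the torus trajectory `x_j = proj (z_s j)` obeys `x_j = SH_j (SV_j x_{j+1})`
  have hx : ∀ j < n, proj (z s j) = SH j (SV j (proj (z s (j + 1)))) := by
    intro j hj
    rw [hz s j hj, hSH, hSV]
    simp only [shearMap_proj]
  -- climbing: `x_j ∈ C j → x_{j'} ∈ C j'` for `j ≤ j' ≤ n`
  have hclimb : ∀ d j, j + d ≤ n → proj (z s j) ∈ C j → proj (z s (j + d)) ∈ C (j + d) := by
    intro d
    induction d with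
    | zero => intro j _ h; simpa using h
    | succ d ih =>
      intro j hj h
      have h' := ih j (by omega) h
      rw [show j + (d + 1) = j + d + 1 by ring, hCsucc]
      refine Or.inr (Or.inr ?_)
      show SH (j + d) (SV (j + d) (proj (z s (j + d + 1)))) ∈ C (j + d)
      rw [← hx (j + d) (by omega)]
      exact h'
  obtain ⟨j', hj', hq⟩ := hnear
  have hmem : proj (z s (j' + 1)) ∈ C (j' + 1) := by
    rw [hCsucc]
    rcases hq with ⟨q, hq⟩
    rcases hq with hV | hH
    · refine Or.inl ?_
      show proj (z s (j' + 1)) 0 ∈ arcs j'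
      rw [proj_apply]
      exact coe_mem_cornerArcs P hN₀ hρ (near_corner_phase P hN₀ hρ (hV3 j' hj') ⟨q, hV⟩)
    · refine Or.inr (Or.inl ?_)
      show SV j' (proj (z s (j' + 1))) 1 ∈ arcs j'
      rw [hSV]
      simp only [shearMap_proj, proj_apply, shearMapLift_apply_coord, if_true, amp_apply]
      exact coe_mem_cornerArcs P hN₀ hρ (near_corner_phase P hN₀ hρ (hH3 j' hj') ⟨q, hH⟩)
  have h := hclimb (n - (j' + 1)) (j' + 1) (by omega) hmem
  rw [show j' + 1 + (n - (j' + 1)) = n by omega, hzn] at h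
  exact h


end Cascade

end Summit.AnomalousDissipation.AnomalousDissipation.Theorems.SawtoothPulseCascade.K1Start
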